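import Mathlib
import Summits.Ventures.PercRepro2.Sep2Defs
import Summits.Ventures.PercRepro2.A3CutPullB

/-!
# The unified o-shield `K = {x, a₁}`: the fibres of `x` across the separator
(blind cell PercRepro2, night-1 g33; proofs/NIGHT1-G33.md §8; census mining/night-1/g33/check_mixed_sep.py,
check_mixed_sep2.py — 152/152)

Setting: `IsSep2 ends x a₁ ↑VA ↑VB EA EB`, the mark `o ∈ VA`, the root `a₂` and the mark `b` in `VB`.
Let `N = {x ↮_A a₁}` (read on the `A`-side).  On a fibre `W ∌ a₁` of the `x`-exploration `x ↮ a₁`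
(`not_conn_x_a1_of_mem_fibre`), so the fibre is the product of the side clusters
(**`fibre_eq_prod`**); the events `{a₁ ↔ o}`, `{a₁ ↔ b}`, `{a₂ ↔ b}` are read on their sides
(`fibre_inter_conn_a1_o`, `fibre_inter_conn_B`), and `{a₂ ↔ o}` is empty on the fibres with a root
(`fibre_inter_conn_a2_o_of_mem_a1`, `fibre_inter_conn_a2_o_of_notMem`).  The root classes
`Q ∩ {x ↔ a₂}` and `PD` are products `N × B_c` (`classC2_eq`, `PDEvent_eq_prod`), and on such a product
`{a₁ ↔ o}` is read on the `A`-side (`N_inter_conn_o`).  The probabilities (conditional independence, the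
`γ`-identity) are Sep2Gamma.lean.  Standard axioms.
-/

namespace Summit.Ventures.PercRepro2

open UnionCluster CovForm CutV Sep2

namespace CovForm

namespace A3Fibre

namespace Sep2Shield

section Sets

variable {V : Type*} {E : Type*} [DecidableEq V] {ends : E → Sym2 V} {x a₁ : V} {VA VB : Finset V}
  {EA EB : Set E} [DecidablePred (· ∈ EA)] [DecidablePred (· ∈ EB)] {a₂ : V}

omit [DecidablePred (· ∈ EA)] [DecidablePred (· ∈ EB)] in
/-- On a fibre of `x`, `x ↔ v` iff `v ∈ W`. -/
lemma fibre_inter_conn_x {W : Finset V} (v : V) :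
    fibre ends a₁ a₂ x W ∩ connEvent ends x v = if v ∈ W then fibre ends a₁ a₂ x W else ∅ := by
  ext ω
  constructor
  · rintro ⟨hω, hv⟩
    have hv' : v ∈ W := by
      have : v ∈ cluster ends ω x := hv
      rw [hω.2] at this
      exact Finset.mem_coe.1 this
    rw [if_pos hv']
    exact hω
  · intro hω
    by_cases hv : v ∈ W
    · rw [if_pos hv] at hω
      refine ⟨hω, ?_⟩
      have : v ∈ cluster ends ω x := by rw [hω.2]; exact Finset.mem_coe.2 hv
      exact this
    · rw [if_neg hv] at hω
      exact absurd hω (Set.notMem_empty ω)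

omit [DecidablePred (· ∈ EA)] [DecidablePred (· ∈ EB)] in
/-- On a fibre `W ∋ y` of `x`, `y ↔ u` iff `u ∈ W`. -/
lemma fibre_inter_conn_of_mem_left {W : Finset V} {y : V} (hy : y ∈ W) (u : V) :
    fibre ends a₁ a₂ x W ∩ connEvent ends y u = if u ∈ W then fibre ends a₁ a₂ x W else ∅ := by
  ext ω
  constructor
  · rintro ⟨hω, hu⟩
    have hxy : Conn ends ω x y := by
      have : y ∈ cluster ends ω x := by rw [hω.2]; exact Finset.mem_coe.2 hy
      exact this
    have hu' : u ∈ W := by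
      have : u ∈ cluster ends ω x := conn_trans hxy hu
      rw [hω.2] at this
      exact Finset.mem_coe.1 this
    rw [if_pos hu']
    exact hω
  · intro hω
    by_cases hu : u ∈ W
    · rw [if_pos hu] at hω
      refine ⟨hω, ?_⟩
      have hxy : Conn ends ω x y := by
        have : y ∈ cluster ends ω x := by rw [hω.2]; exact Finset.mem_coe.2 hy
        exact this
      have hxu : Conn ends ω x u := by
        have : u ∈ cluster ends ω x := by rw [hω.2]; exact Finset.mem_coe.2 hu
        exact this
      exact conn_trans (conn_symm hxy) hxu
    · rw [if_neg hu] at hω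
      exact absurd hω (Set.notMem_empty ω)

omit [DecidableEq V] [DecidablePred (· ∈ EA)] [DecidablePred (· ∈ EB)] in
/-- On a fibre `W ∌ a₁`, `x ↮ a₁`. -/
lemma not_conn_x_a1_of_mem_fibre {W : Finset V} (ha1 : a₁ ∉ W) {ω : Config E}
    (hω : ω ∈ fibre ends a₁ a₂ x W) : ¬ Conn ends ω x a₁ := by
  intro hc
  apply ha1
  have : a₁ ∈ cluster ends ω x := hc
  rw [hω.2] at this
  exact Finset.mem_coe.1 this

omit [DecidableEq V] in
/-- On a fibre `W ∌ a₁`, `{a₁ ↔ o}` is read on the `A`-side for `o ∈ VA`. -/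
lemma fibre_inter_conn_a1_o (h : IsSep2 ends x a₁ ↑VA ↑VB EA EB) {o : V} (ho : o ∈ VA)
    {W : Finset V} (ha1 : a₁ ∉ W) :
    fibre ends a₁ a₂ x W ∩ connEvent ends a₁ o =
      fibre ends a₁ a₂ x W ∩ sideEvent EA (connEvent ends a₁ o) := by
  ext ω
  simp only [Set.mem_inter_iff, mem_sideEvent, mem_connEvent]
  constructor
  · rintro ⟨hω, hc⟩
    exact ⟨hω, (conn_iff_restrict_of_not_conn h (not_conn_x_a1_of_mem_fibre ha1 hω)
      (Or.inr (Or.inr rfl)) (Or.inl (Finset.mem_coe.2 ho))).1 hc⟩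
  · rintro ⟨hω, hc⟩
    exact ⟨hω, conn_mono (restrict_le EA ω) hc⟩

omit [DecidableEq V] in
/-- On a fibre `W ∌ a₁`, a connection between vertices of `VB ∪ {x, a₁}` is read on the
`B`-side. -/
lemma fibre_inter_conn_B (h : IsSep2 ends x a₁ ↑VA ↑VB EA EB) {u v : V}
    (hu : u ∈ (↑VB : Set V) ∪ {x, a₁}) (hv : v ∈ (↑VB : Set V) ∪ {x, a₁}) {W : Finset V}
    (ha1 : a₁ ∉ W) :
    fibre ends a₁ a₂ x W ∩ connEvent ends u v =
      fibre ends a₁ a₂ x W ∩ sideEvent EB (connEvent ends u v) := by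
  ext ω
  simp only [Set.mem_inter_iff, mem_sideEvent, mem_connEvent]
  constructor
  · rintro ⟨hω, hc⟩
    exact ⟨hω, (conn_iff_restrict_of_not_conn h.symm (not_conn_x_a1_of_mem_fibre ha1 hω) hu hv).1 hc⟩
  · rintro ⟨hω, hc⟩
    exact ⟨hω, conn_mono (restrict_le EB ω) hc⟩

omit [DecidableEq V] [DecidablePred (· ∈ EB)] in
/-- On a fibre `W ∋ a₁`, `{a₂ ↔ o}` is empty for `o ∈ VA`, `a₂ ∈ VB`. -/
lemma fibre_inter_conn_a2_o_of_mem_a1 (h : IsSep2 ends x a₁ ↑VA ↑VB EA EB) {o : V} (ho : o ∈ VA)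
    (h2 : a₂ ∈ VB) {W : Finset V} (ha1 : a₁ ∈ W) :
    fibre ends a₁ a₂ x W ∩ connEvent ends a₂ o = ∅ := by
  ext ω
  simp only [Set.mem_inter_iff, mem_connEvent, Set.mem_empty_iff_false, iff_false, not_and]
  intro hω hc
  have hQ : ¬ Conn ends ω a₂ a₁ := by
    have := hω.1
    rw [mem_avoidAll] at this
    exact this a₁ (Finset.mem_singleton_self a₁)
  have hx1 : Conn ends ω x a₁ := by
    have : a₁ ∈ cluster ends ω x := by rw [hω.2]; exact Finset.mem_coe.2 ha1
    exact this
  rcases conn_cross h (Finset.mem_coe.2 ho) (Finset.mem_coe.2 h2) (conn_symm hc) with hox | hoa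
  · exact hQ (conn_trans (conn_trans hc hox) hx1)
  · exact hQ (conn_trans hc hoa)

omit [DecidableEq V] [DecidablePred (· ∈ EB)] in
/-- On a fibre `W` without roots, `{a₂ ↔ o}` is empty for `o ∈ VA`, `a₂ ∈ VB`. -/
lemma fibre_inter_conn_a2_o_of_notMem (h : IsSep2 ends x a₁ ↑VA ↑VB EA EB) {o : V} (ho : o ∈ VA)
    (h2 : a₂ ∈ VB) {W : Finset V} (ha2 : a₂ ∉ W) :
    fibre ends a₁ a₂ x W ∩ connEvent ends a₂ o = ∅ := by
  ext ω
  simp only [Set.mem_inter_iff, mem_connEvent, Set.mem_empty_iff_false, iff_false, not_and]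
  intro hω hc
  have hQ : ¬ Conn ends ω a₂ a₁ := by
    have := hω.1
    rw [mem_avoidAll] at this
    exact this a₁ (Finset.mem_singleton_self a₁)
  rcases conn_cross h (Finset.mem_coe.2 ho) (Finset.mem_coe.2 h2) (conn_symm hc) with hox | hoa
  · apply ha2
    have : a₂ ∈ cluster ends ω x := conn_symm (conn_trans hc hox)
    rw [hω.2] at this
    exact Finset.mem_coe.1 this
  · exact hQ (conn_trans hc hoa)

omit [DecidablePred (· ∈ EA)] [DecidablePred (· ∈ EB)] in
/-- A fibre `W ∌ a₁` not contained in `VA ∪ VB ∪ {x}` is empty. -/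
lemma fibre_eq_empty_of_not_subset (h : IsSep2 ends x a₁ ↑VA ↑VB EA EB) {W : Finset V}
    (ha1 : a₁ ∉ W) (hW : ¬ W ⊆ insert x (VA ∪ VB)) : fibre ends a₁ a₂ x W = ∅ := by
  ext ω
  simp only [Set.mem_empty_iff_false, iff_false]
  intro hω
  apply hW
  intro v hv
  have hv' : v ∈ cluster ends ω x := by rw [hω.2]; exact Finset.mem_coe.2 hv
  rcases mem_union_of_conn h (Or.inr (Or.inl rfl)) hv' with (hvA | hvB) | hvx
  · exact Finset.mem_insert_of_mem (Finset.mem_union_left _ (Finset.mem_coe.1 hvA))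
  · exact Finset.mem_insert_of_mem (Finset.mem_union_right _ (Finset.mem_coe.1 hvB))
  · rcases hvx with rfl | rfl
    · exact Finset.mem_insert_self _ _
    · exact absurd hv ha1

/-- **A fibre `W ∌ a₁` is the product of its side clusters** (with `Q` read on the `B`-side). -/
lemma fibre_eq_prod (h : IsSep2 ends x a₁ ↑VA ↑VB EA EB) (h2 : a₂ ∈ VB) {W : Finset V}
    (ha1 : a₁ ∉ W) (hW : W ⊆ insert x (VA ∪ VB)) :
    fibre ends a₁ a₂ x W =
      sideEvent EA (clusterEvent ends x ↑(W.filter (· ∈ insert x VA))) ∩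
        sideEvent EB (clusterEvent ends x ↑(W.filter (· ∈ insert x VB)) ∩ avoidAll ends a₂ {a₁}) := by
  ext ω
  simp only [fibre, Set.mem_inter_iff, mem_sideEvent, mem_clusterEvent, mem_avoidAll,
    Finset.mem_singleton, forall_eq]
  constructor
  · rintro ⟨hQ, hc⟩
    have hx1 : ¬ Conn ends ω x a₁ := by
      intro hc'
      apply ha1
      have : a₁ ∈ cluster ends ω x := hc'
      rw [hc] at this
      exact Finset.mem_coe.1 this
    have hA : cluster ends (restrict EA ω) x = ↑(W.filter (· ∈ insert x VA)) := by
      ext v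
      simp only [Finset.coe_filter, Set.mem_setOf_eq]
      constructor
      · intro hv
        have hvA := mem_of_conn_restrict h (Or.inr (Or.inl rfl)) hv
        have hv' : v ∈ cluster ends ω x := conn_mono (restrict_le EA ω) hv
        rw [hc] at hv'
        refine ⟨Finset.mem_coe.1 hv', ?_⟩
        rcases hvA with hvA | hvx
        · exact Finset.mem_insert_of_mem (Finset.mem_coe.1 hvA)
        · rcases hvx with rfl | rfl
          · exact Finset.mem_insert_self _ _
          · exact absurd hv (fun hc'' => hx1 (conn_mono (restrict_le EA ω) hc''))
      · rintro ⟨hvW, hvA⟩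
        have hv' : v ∈ cluster ends ω x := by rw [hc]; exact Finset.mem_coe.2 hvW
        have hvA' : v ∈ (↑VA : Set V) ∪ {x, a₁} := by
          rcases Finset.mem_insert.1 hvA with rfl | hvA
          · exact Or.inr (Or.inl rfl)
          · exact Or.inl (Finset.mem_coe.2 hvA)
        exact (conn_iff_restrict_of_not_conn h hx1 (Or.inr (Or.inl rfl)) hvA').1 hv'
    have hB : cluster ends (restrict EB ω) x = ↑(W.filter (· ∈ insert x VB)) := by
      ext v
      simp only [Finset.coe_filter, Set.mem_setOf_eq]
      constructor
      · intro hv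
        have hvB := mem_of_conn_restrict h.symm (Or.inr (Or.inl rfl)) hv
        have hv' : v ∈ cluster ends ω x := conn_mono (restrict_le EB ω) hv
        rw [hc] at hv'
        refine ⟨Finset.mem_coe.1 hv', ?_⟩
        rcases hvB with hvB | hvx
        · exact Finset.mem_insert_of_mem (Finset.mem_coe.1 hvB)
        · rcases hvx with rfl | rfl
          · exact Finset.mem_insert_self _ _
          · exact absurd hv (fun hc'' => hx1 (conn_mono (restrict_le EB ω) hc''))
      · rintro ⟨hvW, hvB⟩
        have hv' : v ∈ cluster ends ω x := by rw [hc]; exact Finset.mem_coe.2 hvW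
        have hvB' : v ∈ (↑VB : Set V) ∪ {x, a₁} := by
          rcases Finset.mem_insert.1 hvB with rfl | hvB
          · exact Or.inr (Or.inl rfl)
          · exact Or.inl (Finset.mem_coe.2 hvB)
        exact (conn_iff_restrict_of_not_conn h.symm hx1 (Or.inr (Or.inl rfl)) hvB').1 hv'
    refine ⟨hA, hB, ?_⟩
    intro hc'
    exact hQ (conn_mono (restrict_le EB ω) hc')
  · rintro ⟨hA, hB, hQ⟩
    have hxA : ¬ Conn ends (restrict EA ω) x a₁ := by
      intro hc'
      have : a₁ ∈ cluster ends (restrict EA ω) x := hc'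
      rw [hA] at this
      exact ha1 (Finset.mem_filter.1 (Finset.mem_coe.1 this)).1
    have hxB : ¬ Conn ends (restrict EB ω) x a₁ := by
      intro hc'
      have : a₁ ∈ cluster ends (restrict EB ω) x := hc'
      rw [hB] at this
      exact ha1 (Finset.mem_filter.1 (Finset.mem_coe.1 this)).1
    have hx1 : ¬ Conn ends ω x a₁ := fun hc' => by
      rcases (conn_x_a1_iff h).1 hc' with hc' | hc'
      · exact hxA hc'
      · exact hxB hc'
    refine ⟨?_, ?_⟩
    · intro hc'
      exact hQ ((conn_iff_restrict_of_not_conn h.symm hx1 (Or.inl (Finset.mem_coe.2 h2))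
        (Or.inr (Or.inr rfl))).1 hc')
    · rw [cluster_eq_union_of_not_conn h hx1, hA, hB]
      ext v
      simp only [Set.mem_union, Finset.coe_filter, Set.mem_setOf_eq, Finset.mem_coe]
      constructor
      · rintro (⟨hv, _⟩ | ⟨hv, _⟩) <;> exact hv
      · intro hv
        rcases Finset.mem_insert.1 (hW hv) with rfl | hv'
        · exact Or.inl ⟨hv, Finset.mem_insert_self _ _⟩
        · rcases Finset.mem_union.1 hv' with hvA | hvB
          · exact Or.inl ⟨hv, Finset.mem_insert_of_mem hvA⟩
          · exact Or.inr ⟨hv, Finset.mem_insert_of_mem hvB⟩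

omit [DecidableEq V] in
/-- `Q ∩ {x ↔ a₂}` is the product `N × {x ↮ a₁, x ↔ a₂, a₂ ↮ a₁}_B`, `N = {x ↮ a₁}_A`. -/
lemma classC2_eq (h : IsSep2 ends x a₁ ↑VA ↑VB EA EB) (h2 : a₂ ∈ VB) :
    avoidAll ends a₂ {a₁} ∩ connEvent ends x a₂ =
      sideEvent EA (connEvent ends x a₁)ᶜ ∩
        sideEvent EB ((connEvent ends x a₁)ᶜ ∩ connEvent ends x a₂ ∩ avoidAll ends a₂ {a₁}) := by
  ext ω
  simp only [Set.mem_inter_iff, mem_sideEvent, mem_connEvent, Set.mem_compl_iff, mem_avoidAll,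
    Finset.mem_singleton, forall_eq]
  constructor
  · rintro ⟨hQ, hc⟩
    have hx1 : ¬ Conn ends ω x a₁ := fun hc' => hQ (conn_trans (conn_symm hc) hc')
    refine ⟨fun hc' => hx1 (conn_mono (restrict_le EA ω) hc'),
      ⟨fun hc' => hx1 (conn_mono (restrict_le EB ω) hc'), ?_⟩, ?_⟩
    · exact (conn_iff_restrict_of_not_conn h.symm hx1 (Or.inr (Or.inl rfl))
        (Or.inl (Finset.mem_coe.2 h2))).1 hc
    · intro hc'
      exact hQ (conn_mono (restrict_le EB ω) hc')
  · rintro ⟨hA, ⟨hB, hc⟩, hQ⟩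
    have hx1 : ¬ Conn ends ω x a₁ := fun hc' => by
      rcases (conn_x_a1_iff h).1 hc' with hc' | hc'
      · exact hA hc'
      · exact hB hc'
    refine ⟨?_, conn_mono (restrict_le EB ω) hc⟩
    intro hc'
    exact hQ ((conn_iff_restrict_of_not_conn h.symm hx1 (Or.inl (Finset.mem_coe.2 h2))
      (Or.inr (Or.inr rfl))).1 hc')

omit [DecidableEq V] in
/-- `PD` is the product `N × {x ↮ a₁, x ↮ a₂, a₁ ↮ a₂}_B`. -/
lemma PDEvent_eq_prod (h : IsSep2 ends x a₁ ↑VA ↑VB EA EB) (h2 : a₂ ∈ VB) :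
    PDEvent ends a₁ a₂ x =
      sideEvent EA (connEvent ends x a₁)ᶜ ∩
        sideEvent EB ((connEvent ends x a₁)ᶜ ∩ (connEvent ends x a₂)ᶜ ∩ (connEvent ends a₁ a₂)ᶜ) := by
  ext ω
  simp only [PDEvent, Dtilde, UnionCluster.inU, Set.mem_inter_iff, mem_sideEvent, mem_connEvent,
    Set.mem_compl_iff, Set.mem_union, not_or]
  constructor
  · rintro ⟨hQ, hx1, hx2⟩
    exact ⟨fun hc' => hx1 (conn_mono (restrict_le EA ω) hc'),
      ⟨fun hc' => hx1 (conn_mono (restrict_le EB ω) hc'),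
        fun hc' => hx2 (conn_mono (restrict_le EB ω) hc')⟩,
      fun hc' => hQ (conn_mono (restrict_le EB ω) hc')⟩
  · rintro ⟨hA, ⟨hB, hx2⟩, hQ⟩
    have hx1 : ¬ Conn ends ω x a₁ := fun hc' => by
      rcases (conn_x_a1_iff h).1 hc' with hc' | hc'
      · exact hA hc'
      · exact hB hc'
    refine ⟨?_, hx1, ?_⟩
    · intro hc'
      exact hQ ((conn_iff_restrict_of_not_conn h.symm hx1 (Or.inr (Or.inr rfl))
        (Or.inl (Finset.mem_coe.2 h2))).1 hc')
    · intro hc'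
      exact hx2 ((conn_iff_restrict_of_not_conn h.symm hx1 (Or.inr (Or.inl rfl))
        (Or.inl (Finset.mem_coe.2 h2))).1 hc')

omit [DecidableEq V] in
/-- On `N × B'` with `B' ⊆ {x ↮_B a₁}`, `{a₁ ↔ o}` is read on the `A`-side. -/
lemma N_inter_conn_o (h : IsSep2 ends x a₁ ↑VA ↑VB EA EB) {o : V} (ho : o ∈ VA)
    {B' : Set (Config E)} (hB' : B' ⊆ (connEvent ends x a₁)ᶜ) :
    sideEvent EA (connEvent ends x a₁)ᶜ ∩ sideEvent EB B' ∩ connEvent ends a₁ o =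
      sideEvent EA ((connEvent ends x a₁)ᶜ ∩ connEvent ends a₁ o) ∩ sideEvent EB B' := by
  ext ω
  simp only [Set.mem_inter_iff, mem_sideEvent, mem_connEvent, Set.mem_compl_iff]
  constructor
  · rintro ⟨⟨hA, hB⟩, hc⟩
    have hx1 : ¬ Conn ends ω x a₁ := fun hc' => by
      rcases (conn_x_a1_iff h).1 hc' with hc' | hc'
      · exact hA hc'
      · exact hB' hB hc'
    exact ⟨⟨hA, (conn_iff_restrict_of_not_conn h hx1 (Or.inr (Or.inr rfl))
      (Or.inl (Finset.mem_coe.2 ho))).1 hc⟩, hB⟩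
  · rintro ⟨⟨hA, hc⟩, hB⟩
    exact ⟨⟨hA, hB⟩, conn_mono (restrict_le EA ω) hc⟩

end Sets

end Sep2Shield

end A3Fibre

end CovForm

end Summit.Ventures.PercRepro2
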